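import Mathlib.RepresentationTheory.Coinduced
import Mathlib.RepresentationTheory.Subrepresentation
import Mathlib.RepresentationTheory.Intertwining
import Mathlib.Topology.Algebra.Group.Quotient
import Literature.NumberTheory.Automorphic.SmoothRepresentation
import HarnessLib

-- provenance: harness21/H21/H21/Prelude/AutomorphicL/SmoothInduction.lean @ bb61a2c (interim HEAD d8f2665); M5 mechanical rewrite
/-!
# Smooth and compact induction (AutomorphicL trunk, item I5 = `G25:SmoothInduction`)

Let `G` be a topological group, `H ≤ G` a subgroup and `σ` a representation of `H` on a
`k`-module `W` (no topology on `W`). This file sets up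

* the *algebraic* induced representation `indFun H σ = Ind_H^G σ`, realised on the space of
  functions `f : G → W` with `f (h g) = σ h (f g)` and `G` acting by right translation
  `(g • f) x = f (x g)` — this **is** Mathlib's `Representation.coind H.subtype σ`;
* the *smooth* induction `smoothInd H σ = (Ind_H^G σ)^∞`, the smooth part
  (`Representation.smoothPart`, item G19) of `indFun H σ`;
* the *compact* induction `cInd H σ = c-Ind_H^G σ`: smooth vectors of `indFun H σ` whose support
  is compact modulo `H` (`IsCompactModSupport`);
* the Frobenius reciprocity map `frobeniusMap π : Hom_G(π, Ind σ) → Hom_H(π|_H, σ)`, evaluation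
  at `1`;

and states (proofs deferred) Frobenius reciprocity, smoothness/admissibility of `Ind`, the
equality `c-Ind = Ind` when `H\G` is compact, and transitivity of induction.

## Mathlib declarations used rather than redefined

`Representation.coind`, `Representation.coindV`, `Representation.mem_coindV`
(algebraic coinduction along a monoid hom, here `H.subtype`), `Representation.IntertwiningMap`
(with its `Module k` structure), `Representation.Equiv`, `Subrepresentation`,
`Subrepresentation.toRepresentation`, `Subgroup.subgroupOf`, `Subgroup.subgroupOfEquivOfLe`,
`QuotientGroup` topology (`CompactSpace (G ⧸ H)`).

## Design notes

* **Algebraic `coind` + smooth part, not `ContRepresentation.coind`.** Mathlib also has a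
  coinduction for continuous representations on *continuous* functions. For totally disconnected
  (locally profinite) groups and representations on bare modules the correct object is the space
  of *locally constant* (`=` smooth for right translation) `H`-equivariant functions, which is
  exactly the smooth part (G19 `Representation.smoothPart`) of the algebraic
  `Representation.coind H.subtype σ`. We therefore do not use `ContRepresentation.coind`
  (outline D4).
* `indFun` is an `abbrev`, so all Mathlib `simp` lemmas about `coind`/`coindV` fire.
* **Carrier synonyms.** The representations themselves are `smoothIndRep H σ` on the type
  synonym `SmoothInd H σ := ↥(smoothInd H σ).toSubmodule` and `cIndRep H σ` on `CInd H σ`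
  (instances by `inferInstanceAs`); see the implementation note on `SmoothInd` for why the
  synonym is needed (instance-path elaboration of `IsSmooth`/`IsAdmissible`/iterated `smoothInd`
  on sub-submodules). `SmoothInd.toFun f : G → W` is the underlying function.
* `G ⧸ H` in Mathlib is the space of *left* cosets `gH`; our functions live on `H\G`, but
  `g ↦ g⁻¹` identifies the two homeomorphically, so `CompactSpace (G ⧸ H)` is the right
  hypothesis for "`H\G` compact".
* Closure properties of `cInd` and the construction of `frobeniusMap` are proved (no `sorry` in
  data), as required by the outline.

## References

* I. N. Bernstein, A. V. Zelevinsky, *Representations of the group `GL(n, F)` where `F` is a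
  non-archimedean local field*, Russian Math. Surveys 31 (1976), §§2.21–2.29.
* C. J. Bushnell, G. Henniart, *The local Langlands conjecture for `GL(2)`* (2006), §2.4–2.5.
-/

open Topology Function Pointwise

namespace Representation

section Algebraic

variable {k G W : Type*} [CommRing k] [Group G] [AddCommGroup W] [Module k W]
  (H : Subgroup G) (σ : Representation k H W)

/-- The **algebraically induced representation** `Ind_H^G σ` of a representation `σ` of a
subgroup `H ≤ G`: the space of functions `f : G → W` with `f (h * g) = σ h (f g)` for `h ∈ H`,
with `G` acting by right translation `(g • f) x = f (x * g)`. This is Mathlib's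
`Representation.coind H.subtype σ` (an `abbrev`).
(Bernstein–Zelevinsky 1976, §2.21; Bushnell–Henniart §2.4.) [cite: BernsteinZelevinsky1976, §2.21] -/
abbrev indFun : Representation k G (coindV H.subtype σ) := coind H.subtype σ

/-- Membership in the space of `Ind_H^G σ`: `f (h g) = σ h (f g)` for all `h ∈ H`, `g ∈ G`
(Mathlib `Representation.mem_coindV`). [folklore] -/
lemma mem_indFun_iff (f : G → W) :
    f ∈ coindV H.subtype σ ↔ ∀ (h : H) (g : G), f (h * g) = σ h (f g) := Iff.rfl

/-- Right translation: `(g • f) x = f (x * g)` on `Ind_H^G σ` (Mathlib `coind_apply`). [folklore] -/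
lemma indFun_apply_apply (g x : G) (f : coindV H.subtype σ) :
    (indFun H σ g f : G → W) x = (f : G → W) (x * g) := rfl

/-- A function `f : G → W` has **compact support modulo `H`** if its support is contained in
`H * C` for some compact `C ⊆ G`, i.e. the image of its support in `H\G` is relatively compact.
(Bernstein–Zelevinsky 1976, §2.22; Bushnell–Henniart §2.5.) [cite: BernsteinZelevinsky1976, §2.22] -/
def IsCompactModSupport [TopologicalSpace G] (f : G → W) : Prop :=
  ∃ C : Set G, IsCompact C ∧ support f ⊆ (H : Set G) * C

variable {H} in
/-- The zero function has compact support modulo `H`. [folklore] -/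
lemma IsCompactModSupport.zero [TopologicalSpace G] : IsCompactModSupport H (0 : G → W) :=
  ⟨∅, isCompact_empty, by simp⟩

variable {H} in
/-- Compact support modulo `H` is stable under addition. [folklore] -/
lemma IsCompactModSupport.add [TopologicalSpace G] {f g : G → W} (hf : IsCompactModSupport H f)
    (hg : IsCompactModSupport H g) : IsCompactModSupport H (f + g) := by
  obtain ⟨C, hC, hfC⟩ := hf
  obtain ⟨D, hD, hgD⟩ := hg
  refine ⟨C ∪ D, hC.union hD, (support_add f g).trans ?_⟩
  rw [Set.mul_union]
  exact Set.union_subset_union hfC hgD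

variable {H} in
/-- Compact support modulo `H` is stable under scalar multiplication. [folklore] -/
lemma IsCompactModSupport.smul [TopologicalSpace G] (c : k) {f : G → W}
    (hf : IsCompactModSupport H f) : IsCompactModSupport H (c • f) := by
  obtain ⟨C, hC, hfC⟩ := hf
  exact ⟨C, hC, (support_const_smul_subset c f).trans hfC⟩

variable {H} in
/-- Compact support modulo `H` is stable under right translation: if `supp f ⊆ H C` then
`supp (x ↦ f (x g)) ⊆ H (C g⁻¹)`. [folklore] -/
lemma IsCompactModSupport.comp_mul_right [TopologicalSpace G] [SeparatelyContinuousMul G]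
    (g : G) {f : G → W} (hf : IsCompactModSupport H f) :
    IsCompactModSupport H (fun x => f (x * g)) := by
  obtain ⟨C, hC, hfC⟩ := hf
  refine ⟨(· * g⁻¹) '' C, hC.image (continuous_mul_const g⁻¹), fun x hx => ?_⟩
  have hxg : x * g ∈ (H : Set G) * C := hfC hx
  obtain ⟨h, hh, c, hc, hhc⟩ := Set.mem_mul.1 hxg
  refine Set.mem_mul.2 ⟨h, hh, c * g⁻¹, Set.mem_image_of_mem _ hc, ?_⟩
  rw [← mul_assoc, hhc, mul_inv_cancel_right]

end Algebraic

section Smooth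

variable {k G W : Type*} [CommRing k] [Group G] [TopologicalSpace G] [SeparatelyContinuousMul G]
  [AddCommGroup W] [Module k W] (H : Subgroup G) (σ : Representation k H W)

/-- The **smooth induced representation** `Ind_H^G σ = (indFun H σ)^∞`: the smooth part
(`Representation.smoothPart`, vectors with open stabiliser under right translation) of the
algebraic induction, as a subrepresentation of `indFun H σ`.
(Bernstein–Zelevinsky 1976, §2.21; Bushnell–Henniart §2.4.) [cite: BernsteinZelevinsky1976, §2.21] -/
def smoothInd : Subrepresentation (indFun H σ) := (indFun H σ).smoothPart

/-- Membership in the smooth induction: `f ∈ Ind_H^G σ` iff `f` is a smooth vector for right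
translation. [folklore] -/
@[simp] lemma mem_smoothInd (f : coindV H.subtype σ) :
    f ∈ smoothInd H σ ↔ (indFun H σ).IsSmoothVector f := Iff.rfl

/-- The **compactly induced representation** `c-Ind_H^G σ`: smooth vectors of `indFun H σ`
whose support is compact modulo `H`, as a subrepresentation of `indFun H σ`.
(Bernstein–Zelevinsky 1976, §2.22; Bushnell–Henniart §2.5.) [cite: BernsteinZelevinsky1976, §2.22] -/
def cInd : Subrepresentation (indFun H σ) where
  toSubmodule :=
    { carrier := {f | (indFun H σ).IsSmoothVector f ∧ IsCompactModSupport H (f : G → W)}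
      zero_mem' := ⟨(indFun H σ).isSmoothVector_zero, IsCompactModSupport.zero⟩
      add_mem' := fun hf hg => ⟨hf.1.add _ hg.1, hf.2.add hg.2⟩
      smul_mem' := fun c _ hf => ⟨hf.1.smul _ c, hf.2.smul c⟩ }
  apply_mem_toSubmodule g _ hf := ⟨hf.1.apply _ g, hf.2.comp_mul_right g⟩

/-- Membership in the compact induction. [folklore] -/
@[simp] lemma mem_cInd (f : coindV H.subtype σ) :
    f ∈ cInd H σ ↔ (indFun H σ).IsSmoothVector f ∧ IsCompactModSupport H (f : G → W) :=
  Iff.rfl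

/-- `c-Ind_H^G σ ≤ Ind_H^G σ`. (Bernstein–Zelevinsky 1976, §2.22.) [cite: BernsteinZelevinsky1976, §2.22] -/
lemma cInd_le_smoothInd : cInd H σ ≤ smoothInd H σ := fun _ hf => hf.1

/-! ### Carrier synonyms and the induced representations -/

/-- The carrier type of the smooth induction `Ind_H^G σ`: a type synonym for
`↥(smoothInd H σ).toSubmodule`.

Implementation note (same device as `Representation.Contragredient` in G19): on a submodule `p`
of the submodule `coindV H.subtype σ` the instance `Submodule.addCommMonoid p` is not
*syntactically* `AddCommGroup.toAddCommMonoid _`, and Lean fails to elaborate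
`ρ'.IsSmooth`, `ρ'.IsAdmissible`, `smoothInd H ρ'`, … for `ρ' := (smoothInd H σ).toRepresentation`
without explicit `(V := _)` arguments. Declaring the instances on a synonym by `inferInstanceAs`
(no new structure) fixes the instance path. [folklore] -/
def SmoothInd : Type _ := ↥(smoothInd H σ).toSubmodule

/-- The additive group structure on `Ind_H^G σ`, transported from the submodule. [folklore] -/
instance SmoothInd.instAddCommGroup : AddCommGroup (SmoothInd H σ) :=
  inferInstanceAs (AddCommGroup ↥(smoothInd H σ).toSubmodule)

/-- The `k`-module structure on `Ind_H^G σ`, transported from the submodule. [folklore] -/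
instance SmoothInd.instModule : Module k (SmoothInd H σ) :=
  inferInstanceAs (Module k ↥(smoothInd H σ).toSubmodule)

variable {H σ} in
/-- The underlying function `G → W` of an element of `Ind_H^G σ`. [folklore] -/
def SmoothInd.toFun (f : SmoothInd H σ) : G → W :=
  (((show ↥(smoothInd H σ).toSubmodule from f) : coindV H.subtype σ) : G → W)

variable {H σ} in
/-- Two elements of `Ind_H^G σ` with the same underlying function are equal. [folklore] -/
@[ext] lemma SmoothInd.ext {f g : SmoothInd H σ} (h : f.toFun = g.toFun) : f = g :=
  Subtype.ext (Subtype.ext h)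

variable {H σ} in
/-- The underlying function of `f ∈ Ind_H^G σ` satisfies `f (h g) = σ h (f g)`. [folklore] -/
lemma SmoothInd.toFun_subgroup_mul (f : SmoothInd H σ) (h : H) (g : G) :
    f.toFun (h * g) = σ h (f.toFun g) :=
  (mem_indFun_iff H σ _).1 (show ↥(smoothInd H σ).toSubmodule from f).1.2 h g

/-- The **smooth induced representation** `Ind_H^G σ` of `G` on the carrier `SmoothInd H σ`
(`Subrepresentation.toRepresentation` of `smoothInd H σ`).
(Bernstein–Zelevinsky 1976, §2.21; Bushnell–Henniart §2.4.) [cite: BernsteinZelevinsky1976, §2.21] -/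
def smoothIndRep : Representation k G (SmoothInd H σ) := (smoothInd H σ).toRepresentation

variable {H σ} in
/-- `Ind_H^G σ` acts by right translation: `(g • f) x = f (x g)`. [folklore] -/
@[simp] lemma toFun_smoothIndRep_apply (g : G) (f : SmoothInd H σ) (x : G) :
    (smoothIndRep H σ g f).toFun x = f.toFun (x * g) := rfl

variable {H σ} in
/-- `toFun` is additive. [folklore] -/
@[simp] lemma SmoothInd.toFun_add (f g : SmoothInd H σ) : (f + g).toFun = f.toFun + g.toFun :=
  rfl

variable {H σ} in
/-- `toFun` commutes with scalars. [folklore] -/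
@[simp] lemma SmoothInd.toFun_smul (c : k) (f : SmoothInd H σ) : (c • f).toFun = c • f.toFun :=
  rfl

/-- The carrier type of the compact induction `c-Ind_H^G σ`: a type synonym for
`↥(cInd H σ).toSubmodule` (see the implementation note on `SmoothInd`). [folklore] -/
def CInd : Type _ := ↥(cInd H σ).toSubmodule

/-- The additive group structure on `c-Ind_H^G σ`, transported from the submodule. [folklore] -/
instance CInd.instAddCommGroup : AddCommGroup (CInd H σ) :=
  inferInstanceAs (AddCommGroup ↥(cInd H σ).toSubmodule)

/-- The `k`-module structure on `c-Ind_H^G σ`, transported from the submodule. [folklore] -/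
instance CInd.instModule : Module k (CInd H σ) :=
  inferInstanceAs (Module k ↥(cInd H σ).toSubmodule)

/-- The **compactly induced representation** `c-Ind_H^G σ` of `G` on the carrier `CInd H σ`
(`Subrepresentation.toRepresentation` of `cInd H σ`).
(Bernstein–Zelevinsky 1976, §2.22; Bushnell–Henniart §2.5.) [cite: BernsteinZelevinsky1976, §2.22] -/
def cIndRep : Representation k G (CInd H σ) := (cInd H σ).toRepresentation

/-- The inclusion `c-Ind_H^G σ → Ind_H^G σ` as an intertwining map (from `cInd_le_smoothInd`). [folklore] -/
def cIndToSmoothInd : (cIndRep H σ).IntertwiningMap (smoothIndRep H σ) where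
  toLinearMap :=
    { toFun := fun f => (⟨(show ↥(cInd H σ).toSubmodule from f).1,
        cInd_le_smoothInd H σ (show ↥(cInd H σ).toSubmodule from f).2⟩ :
          ↥(smoothInd H σ).toSubmodule)
      map_add' := fun _ _ => rfl
      map_smul' := fun _ _ => rfl }
  isIntertwining' := fun _ => rfl

/-- The inclusion `c-Ind_H^G σ → Ind_H^G σ` is injective. [folklore] -/
lemma cIndToSmoothInd_injective : Function.Injective (cIndToSmoothInd H σ) := by
  intro f g hfg
  have := congrArg Subtype.val (show _ = _ from hfg)
  exact Subtype.ext this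

/-- The smooth induction is a smooth representation (`Representation.isSmooth_smoothPart`).
(Bernstein–Zelevinsky 1976, §2.21.) [cite: BernsteinZelevinsky1976, §2.21] -/
theorem isSmooth_smoothInd : (smoothIndRep H σ).IsSmooth :=
  (indFun H σ).isSmooth_smoothPart

/-- The compact induction is a smooth representation. (Bernstein–Zelevinsky 1976, §2.22.) [cite: BernsteinZelevinsky1976, §2.22] -/
theorem isSmooth_cInd : (cIndRep H σ).IsSmooth := by
  intro f
  have : ((cIndRep H σ).stabilizerSubgroup f : Set G) =
      ((indFun H σ).stabilizerSubgroup (show ↥(cInd H σ).toSubmodule from f).1 : Set G) := by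
    ext g
    simp only [SetLike.mem_coe, mem_stabilizerSubgroup, cIndRep,
      Subrepresentation.toRepresentation]
    exact Subtype.ext_iff
  rw [IsSmoothVector, this]
  exact (show ↥(cInd H σ).toSubmodule from f).2.1

/-! ### Frobenius reciprocity -/

variable {V : Type*} [AddCommGroup V] [Module k V] (π : Representation k G V)

/-- The **Frobenius reciprocity map** `Hom_G(π, Ind_H^G σ) →ₗ[k] Hom_H(π|_H, σ)`,
`T ↦ (v ↦ (T v) 1)` (evaluation at the identity).
(Bernstein–Zelevinsky 1976, Proposition 2.28; Bushnell–Henniart §2.4.) [cite: BernsteinZelevinsky1976, Proposition 2.28] -/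
def frobeniusMap :
    π.IntertwiningMap (smoothIndRep H σ) →ₗ[k] IntertwiningMap (π.comp H.subtype) σ where
  toFun T :=
    { toLinearMap :=
        { toFun := fun v => (T v).toFun 1
          map_add' := fun v w => by simp
          map_smul' := fun c v => by simp }
      isIntertwining' := fun h => by
        ext v
        simp only [LinearMap.coe_comp, LinearMap.coe_mk, AddHom.coe_mk, Function.comp_apply,
          MonoidHom.coe_comp, Subgroup.coe_subtype]
        rw [T.isIntertwining, toFun_smoothIndRep_apply, one_mul, ← mul_one (h : G),
          SmoothInd.toFun_subgroup_mul] }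
  map_add' T₁ T₂ := by ext; rfl
  map_smul' c T := by ext; rfl

/-- The Frobenius map is evaluation at `1`. [folklore] -/
@[simp] lemma frobeniusMap_apply (T : π.IntertwiningMap (smoothIndRep H σ)) (v : V) :
    frobeniusMap H σ π T v = (T v).toFun 1 := rfl

/-- **Frobenius reciprocity** for smooth induction: for a smooth representation `π` of `G`,
evaluation at `1` is a bijection `Hom_G(π, Ind_H^G σ) ≃ Hom_H(π|_H, σ)`; the inverse sends
`φ` to `v ↦ (g ↦ φ (π g v))` (a smooth vector since its stabiliser contains that of `v`).
(Bernstein–Zelevinsky 1976, Proposition 2.28; Bushnell–Henniart §2.4.) [cite: BernsteinZelevinsky1976, Proposition 2.28] -/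
def frobeniusMap_bijective : Prop :=
  ∀ (hπ : π.IsSmooth),
    Function.Bijective (frobeniusMap H σ π)

end Smooth

section Admissible

variable {k G W : Type*} [CommRing k] [Group G] [TopologicalSpace G]
  [AddCommGroup W] [Module k W] (H : Subgroup G) (σ : Representation k H W)

/-- If `H` is closed, `H\G` is compact and `σ` is admissible, then `Ind_H^G σ` is admissible: for
a compact open `K`, the double coset space `H\G/K` is finite and
`(Ind σ)^K ≅ ⊕_{HgK} W^{H ∩ g K g⁻¹}`.
(Bernstein–Zelevinsky 1976, §2.25; Bushnell–Henniart §2.4.) [cite: BernsteinZelevinsky1976, §2.25] -/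
def isAdmissible_smoothInd : Prop :=
  ∀ [NonarchimedeanGroup G] [LocallyCompactSpace G] [T2Space G] [CompactSpace (G ⧸ H)] (hH : IsClosed (H : Set G)) (hσ : σ.IsAdmissible),
    (smoothIndRep H σ).IsAdmissible

/-- If `H\G` is compact (and `G` locally compact) then compact and smooth induction agree:
`c-Ind_H^G σ = Ind_H^G σ`, since `G = H C` for a compact `C`.
(Bernstein–Zelevinsky 1976, §2.22; Bushnell–Henniart §2.5.) [cite: BernsteinZelevinsky1976, §2.22] -/
def cInd_eq_smoothInd_of_compactSpace_quotient : Prop :=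
  ∀ [IsTopologicalGroup G] [LocallyCompactSpace G] [CompactSpace (G ⧸ H)],
    cInd H σ = smoothInd H σ

/-- **Transitivity of induction**: for subgroups `K ≤ H ≤ G` and a representation `τ` of `K`,
`Ind_H^G (Ind_K^H τ) ≅ Ind_K^G τ` as representations of `G` (here `Ind_K^H` is induction along
`K.subgroupOf H ≤ H`, with `τ` transported by `Subgroup.subgroupOfEquivOfLe`).
(Bernstein–Zelevinsky 1976, Proposition 2.25(b); Bushnell–Henniart §2.4.) [cite: BernsteinZelevinsky1976, Proposition 2.25(b] -/
def smoothInd_trans : Prop :=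
  ∀ [IsTopologicalGroup G] (K : Subgroup G) (hKH : K ≤ H) (τ : Representation k K W),
    Nonempty
      ((smoothIndRep H (smoothIndRep (K.subgroupOf H)
          (τ.comp (Subgroup.subgroupOfEquivOfLe hKH).toMonoidHom))).Equiv
        (smoothIndRep K τ))

end Admissible

/-! ### Proof of Frobenius reciprocity

Discharge of the named fact `frobeniusMap_bijective` (Bernstein–Zelevinsky 1976,
Proposition 2.28). The argument formalised below is the one printed in Bump 1997,
Proposition 4.5.1 and its proof (pp. 470–471 of the held copy; Bump works with normalised
induction, the twist by `δ_G^{-1/2} δ_H^{1/2}` being absent here because `indFun` is unnormalised):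
the inverse of `T ↦ (v ↦ (T v) 1)` sends `φ ∈ Hom_H(π|_H, σ)` to `Φ` with `Φ v := (g ↦ φ (π g v))`;
`Φ v` satisfies `f (h g) = σ h (f g)` because `φ` is `H`-equivariant ("property (i) is a formal
verification"), it is a smooth vector because its stabiliser under right translation contains the
open stabiliser of `v` ("property (ii) follows from the smoothness of `σ`"), `Φ` is `G`-equivariant,
and the two maps are mutually inverse. -/

section FrobeniusReciprocityProof

variable {k G W V : Type*} [CommRing k] [Group G] [AddCommGroup W] [Module k W]
  [AddCommGroup V] [Module k V] {H : Subgroup G} {σ : Representation k H W}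
  {π : Representation k G V}

/-- For an `H`-map `φ : π|_H → σ` and a vector `v`, the function `g ↦ φ (π g v)` as an element of
the algebraic induction `Ind_H^G σ`: it satisfies `f (h g) = σ h (f g)` because `φ` is
`H`-equivariant. (Bump 1997, proof of Proposition 4.5.1, property (i).)
[cite: BernsteinZelevinsky1976, Proposition 2.28] -/
def frobeniusInvFun (φ : IntertwiningMap (π.comp H.subtype) σ) (v : V) : coindV H.subtype σ :=
  ⟨fun g => φ (π g v), (mem_indFun_iff H σ _).2 fun h g => by
    show φ (π ((h : G) * g) v) = σ h (φ (π g v))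
    rw [map_mul, Module.End.mul_apply]
    exact φ.isIntertwining _ _ h (π g v)⟩

/-- Pointwise formula for `frobeniusInvFun`: `(frobeniusInvFun φ v) g = φ (π g v)`. [folklore] -/
@[simp] lemma frobeniusInvFun_apply (φ : IntertwiningMap (π.comp H.subtype) σ) (v : V) (g : G) :
    (frobeniusInvFun φ v : G → W) g = φ (π g v) := rfl

variable [TopologicalSpace G] [SeparatelyContinuousMul G]

/-- If `π` is smooth then `g ↦ φ (π g v)` is a smooth vector of `Ind_H^G σ` for right
translation: its stabiliser contains the (open) stabiliser of `v` in `π`, since `π g₀ v = v`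
gives `φ (π (x g₀) v) = φ (π x v)`. (Bump 1997, proof of Proposition 4.5.1, property (ii).)
[cite: BernsteinZelevinsky1976, Proposition 2.28] -/
lemma isSmoothVector_frobeniusInvFun (hπ : π.IsSmooth)
    (φ : IntertwiningMap (π.comp H.subtype) σ) (v : V) :
    (indFun H σ).IsSmoothVector (frobeniusInvFun φ v) := by
  refine (indFun H σ).isSmoothVector_of_le (K := π.stabilizerSubgroup v) (hπ v) fun g hg => ?_
  simp only [mem_stabilizerSubgroup] at hg ⊢
  refine Subtype.ext (funext fun x => ?_)
  simp only [indFun_apply_apply, frobeniusInvFun_apply, map_mul, Module.End.mul_apply, hg]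

/-- The vector `Φ v := (g ↦ φ (π g v))` of the smooth induction `Ind_H^G σ` attached to
`φ ∈ Hom_H(π|_H, σ)` and `v`, for a smooth representation `π`.
(Bump 1997, proof of Proposition 4.5.1.) [cite: BernsteinZelevinsky1976, Proposition 2.28] -/
def frobeniusInvVec (hπ : π.IsSmooth) (φ : IntertwiningMap (π.comp H.subtype) σ) (v : V) :
    SmoothInd H σ :=
  (⟨frobeniusInvFun φ v, isSmoothVector_frobeniusInvFun hπ φ v⟩ : ↥(smoothInd H σ).toSubmodule)

/-- Pointwise formula: `(Φ v) g = φ (π g v)`. [folklore] -/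
@[simp] lemma toFun_frobeniusInvVec (hπ : π.IsSmooth)
    (φ : IntertwiningMap (π.comp H.subtype) σ) (v : V) (g : G) :
    (frobeniusInvVec hπ φ v).toFun g = φ (π g v) := rfl

/-- The **inverse Frobenius map** `Hom_H(π|_H, σ) → Hom_G(π, Ind_H^G σ)` for a smooth
representation `π`: `φ ↦ Φ`, `Φ v := (g ↦ φ (π g v))`. It is `k`-linear in `v` and
`G`-equivariant: `Φ (π g v) = (x ↦ φ (π (x g) v)) = g • Φ v`.
(Bump 1997, proof of Proposition 4.5.1.) [cite: BernsteinZelevinsky1976, Proposition 2.28] -/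
def frobeniusInv (hπ : π.IsSmooth) (φ : IntertwiningMap (π.comp H.subtype) σ) :
    π.IntertwiningMap (smoothIndRep H σ) where
  toLinearMap :=
    { toFun := frobeniusInvVec hπ φ
      map_add' := fun v w => by
        refine SmoothInd.ext (funext fun g => ?_)
        simp only [SmoothInd.toFun_add, Pi.add_apply, toFun_frobeniusInvVec, map_add]
      map_smul' := fun c v => by
        refine SmoothInd.ext (funext fun g => ?_)
        simp only [SmoothInd.toFun_smul, Pi.smul_apply, toFun_frobeniusInvVec, map_smul,
          RingHom.id_apply] }
  isIntertwining' g := by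
    refine LinearMap.ext fun v => SmoothInd.ext (funext fun x => ?_)
    simp only [LinearMap.coe_comp, LinearMap.coe_mk, AddHom.coe_mk, Function.comp_apply,
      toFun_frobeniusInvVec, toFun_smoothIndRep_apply, map_mul, Module.End.mul_apply]

/-- Pointwise formula for the inverse Frobenius map: `(frobeniusInv hπ φ v) g = φ (π g v)`. [folklore] -/
@[simp] lemma toFun_frobeniusInv_apply (hπ : π.IsSmooth)
    (φ : IntertwiningMap (π.comp H.subtype) σ) (v : V) (g : G) :
    (frobeniusInv hπ φ v).toFun g = φ (π g v) := rfl

/-- `frobeniusMap ∘ frobeniusInv = id`: `(g ↦ φ (π g v)) 1 = φ (π 1 v) = φ v`.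
(Bump 1997, proof of Proposition 4.5.1.) [cite: BernsteinZelevinsky1976, Proposition 2.28] -/
lemma frobeniusMap_frobeniusInv (hπ : π.IsSmooth) (φ : IntertwiningMap (π.comp H.subtype) σ) :
    frobeniusMap H σ π (frobeniusInv hπ φ) = φ := by
  refine IntertwiningMap.ext (LinearMap.ext fun v => ?_)
  rw [IntertwiningMap.toLinearMap_apply, IntertwiningMap.toLinearMap_apply, frobeniusMap_apply,
    toFun_frobeniusInv_apply, map_one, Module.End.one_apply]

/-- `frobeniusInv ∘ frobeniusMap = id`: for `T ∈ Hom_G(π, Ind_H^G σ)`,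
`(T v) g = (g • T v) 1 = (T (π g v)) 1`. (Bump 1997, proof of Proposition 4.5.1.)
[cite: BernsteinZelevinsky1976, Proposition 2.28] -/
lemma frobeniusInv_frobeniusMap (hπ : π.IsSmooth) (T : π.IntertwiningMap (smoothIndRep H σ)) :
    frobeniusInv hπ (frobeniusMap H σ π T) = T := by
  refine IntertwiningMap.ext (LinearMap.ext fun v => SmoothInd.ext (funext fun g => ?_))
  rw [IntertwiningMap.toLinearMap_apply, IntertwiningMap.toLinearMap_apply,
    toFun_frobeniusInv_apply, frobeniusMap_apply, T.isIntertwining, toFun_smoothIndRep_apply,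
    one_mul]

/-- **Frobenius reciprocity** as a `k`-linear equivalence
`Hom_G(π, Ind_H^G σ) ≃ₗ[k] Hom_H(π|_H, σ)` for a smooth representation `π`: the Frobenius map
(evaluation at `1`) with inverse `frobeniusInv`.
(Bump 1997, Proposition 4.5.1.) [cite: BernsteinZelevinsky1976, Proposition 2.28] -/
def frobeniusEquiv (hπ : π.IsSmooth) :
    π.IntertwiningMap (smoothIndRep H σ) ≃ₗ[k] IntertwiningMap (π.comp H.subtype) σ :=
  { frobeniusMap H σ π with
    invFun := frobeniusInv hπ
    left_inv := frobeniusInv_frobeniusMap hπ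
    right_inv := frobeniusMap_frobeniusInv hπ }

/-- The Frobenius equivalence is the Frobenius map. [folklore] -/
@[simp] lemma coe_frobeniusEquiv (hπ : π.IsSmooth) :
    ⇑(frobeniusEquiv (H := H) (σ := σ) hπ) = frobeniusMap H σ π := rfl

/-- The inverse of the Frobenius equivalence is `frobeniusInv`. [folklore] -/
@[simp] lemma coe_frobeniusEquiv_symm (hπ : π.IsSmooth) :
    ⇑(frobeniusEquiv (H := H) (σ := σ) hπ).symm = frobeniusInv hπ := rfl

end FrobeniusReciprocityProof

section FrobeniusReciprocityHolds

variable {k G W : Type*} [CommRing k] [Group G] [TopologicalSpace G] [SeparatelyContinuousMul G]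
  [AddCommGroup W] [Module k W] (H : Subgroup G) (σ : Representation k H W)

variable {V : Type*} [AddCommGroup V] [Module k V] (π : Representation k G V)

/-- **Frobenius reciprocity** (discharge of the named fact `frobeniusMap_bijective`): for a
smooth representation `π` of `G`, evaluation at `1` is a bijection
`Hom_G(π, Ind_H^G σ) → Hom_H(π|_H, σ)`, with inverse `frobeniusInv`
(`φ ↦ (v ↦ (g ↦ φ (π g v)))`).
(Bernstein–Zelevinsky 1976, Proposition 2.28; proof as printed in Bump 1997,
Proposition 4.5.1, pp. 470–471; Bushnell–Henniart 2006, §2.4.)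
[cite: BernsteinZelevinsky1976, Proposition 2.28] -/
theorem frobeniusMap_bijective_holds : frobeniusMap_bijective H σ π := fun hπ =>
  Function.bijective_iff_has_inverse.2
    ⟨frobeniusInv hπ, frobeniusInv_frobeniusMap hπ, frobeniusMap_frobeniusInv hπ⟩

end FrobeniusReciprocityHolds

end Representation
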